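import Literature.Analysis.FluidPDE.AxisymHouLiVariables
import Literature.Analysis.FluidPDE.SwirlTransportProofs
import Literature.Analysis.FluidPDE.VorticityStretching
import HarnessLib

/-!
# The smoothed Hill spherical vortex, III: vector calculus of a poloidal profile field

Cell `ns-blowup`, seat `ns-blowup-fc-prover-3` (g6). LABEL: kinematics (definitions with bodies +
proved identities; no named fact; nothing about Navier–Stokes dynamics is asserted). WHAT THIS IS
NOT: not NS evidence — explicit vector calculus of a family of smooth axisymmetric swirl-free fields,
used by the cell as the LAZY ENVELOPE SLICE of the negative lane of crux `HeredityAtOne`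
(stmt-NavierStokesRegularity-19249).

For two scalar profiles `S, P : ℝ → ℝ` of the variable `s = |x|²` with `P' = S`, the field
`u = curl (P(|x|²) e_z × x)` has the Cartesian form
`u(x) = (−2 S x₀x₂, −2 S x₁x₂, 2 P + 2 S (x₀² + x₁²))` (profiles evaluated at `|x|²`) — Hill's
spherical vortex is the case `P` quadratic inside / `∝ s^{-3/2}` outside (M. J. M. Hill 1894;
Acheson §5.5; tree `HillSphericalVortex.lean`, `hillCoreU/V/W`), the SMOOTHED Hill vortex of
`SmoothedHillVortexProfile/Potential.lean` the case `S = slope`, `P = potential`. This file is the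
profile-generic calculus:

* `profileField S P`, `rsq`, smoothness `contDiff_profileField`;
* the JACOBIAN `fderiv_profileField_single` (all nine `∂ⱼuᵢ`, with `S' =` the derivative of `S`);
* `isDivFree_profileField` (`div u = 0`), `curl_profileField`
  (`curl u = quotOf S S' (|x|²) • (−x₁, x₀, 0)` with `quotOf S S' s = −(10 S(s) + 4 s S'(s))`),
  `hasNoSwirl_profileField`, `isAxisymmetric_profileField`, `swirl_curl_profileField`
  (`= quotOf · r²`), and `angVortQuot_profileField`: **`ω_θ / r = quotOf S S' (|x|²)`** everywhere;
* `norm_sq_profileField` (the speed in closed form).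

References: M. J. M. Hill, Phil. Trans. R. Soc. London A 185 (1894) 213–245 [cite: Hill1894, Art. 1–4];
D. J. Acheson, *Elementary Fluid Dynamics* (OUP 1990) §5.5 [cite: Acheson1990, §5.5, eqs. (5.15)–(5.25)];
G. Koch, N. Nadirashvili, G. Seregin, V. Šverák, Acta Math. 203 (2009) §5 (the quotient `ω_θ/r`)
[cite: KochNadirashviliSereginSverak2009, §5 Remark 5.1].
-/

noncomputable section

open Real Set Function
open scoped ContDiff

namespace Summit.NavierStokesRegularity.FluidComputer

namespace SmoothedHill

open Literature.Analysis.FluidPDE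

local notation "ℝ³" => EuclideanSpace ℝ (Fin 3)

variable (S P S' : ℝ → ℝ)

/-! ## The field -/

/-- `|x|²` as the coordinate polynomial `x₀² + x₁² + x₂²`. [folklore] -/
def rsq (x : ℝ³) : ℝ := x 0 ^ 2 + x 1 ^ 2 + x 2 ^ 2

/-- `rsq x = ‖x‖²`. [folklore] -/
theorem rsq_eq_norm_sq (x : ℝ³) : rsq x = ‖x‖ ^ 2 := by
  rw [EuclideanSpace.real_norm_sq_eq, Fin.sum_univ_three, rsq]

/-- `0 ≤ rsq x`. [folklore] -/
theorem rsq_nonneg (x : ℝ³) : 0 ≤ rsq x := by unfold rsq; positivity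

/-- `x₀² + x₁² ≤ rsq x`. [folklore] -/
theorem cyl_sq_le_rsq (x : ℝ³) : x 0 ^ 2 + x 1 ^ 2 ≤ rsq x := by
  unfold rsq; nlinarith [sq_nonneg (x 2)]

/-- **The poloidal field of the profiles `(S, P)`**:
`u(x) = (−2 S(|x|²) x₀x₂, −2 S(|x|²) x₁x₂, 2 P(|x|²) + 2 S(|x|²)(x₀² + x₁²))`, the Cartesian form of
`curl (P(|x|²) e_z × x)` when `P' = S` (Hill's core: `S` constant, `P` affine — Acheson (5.25),
tree `hillCoreU/V/W`). [cite: Acheson1990, §5.5, eq. (5.25)] -/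
def profileField (x : ℝ³) : ℝ³ :=
  !₂[-2 * S (rsq x) * x 0 * x 2, -2 * S (rsq x) * x 1 * x 2,
    2 * P (rsq x) + 2 * S (rsq x) * (x 0 ^ 2 + x 1 ^ 2)]

/-- Component `0`. [folklore] -/
@[simp] theorem profileField_apply_zero (x : ℝ³) :
    profileField S P x 0 = -2 * S (rsq x) * x 0 * x 2 := by simp [profileField]

/-- Component `1`. [folklore] -/
@[simp] theorem profileField_apply_one (x : ℝ³) :
    profileField S P x 1 = -2 * S (rsq x) * x 1 * x 2 := by simp [profileField]

/-- Component `2`. [folklore] -/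
@[simp] theorem profileField_apply_two (x : ℝ³) :
    profileField S P x 2 = 2 * P (rsq x) + 2 * S (rsq x) * (x 0 ^ 2 + x 1 ^ 2) := by
  simp [profileField]

/-- Expansion in the standard basis. [folklore] -/
theorem profileField_eq (x : ℝ³) : profileField S P x = (-2 * S (rsq x) * x 0 * x 2) • (EuclideanSpace.single (0 : Fin 3) (1 : ℝ)) +
    (-2 * S (rsq x) * x 1 * x 2) • (EuclideanSpace.single (1 : Fin 3) (1 : ℝ)) +
    (2 * P (rsq x) + 2 * S (rsq x) * (x 0 ^ 2 + x 1 ^ 2)) • (EuclideanSpace.single (2 : Fin 3) (1 : ℝ)) := by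
  ext i; fin_cases i <;> simp [profileField]

/-- The coordinate functions are the projections. [folklore] -/
private theorem hasFDerivAt_coord (j : Fin 3) (x : ℝ³) :
    HasFDerivAt (fun y : ℝ³ => y j) (EuclideanSpace.proj j : ℝ³ →L[ℝ] ℝ) x :=
  (EuclideanSpace.proj j : ℝ³ →L[ℝ] ℝ).hasFDerivAt

/-- `rsq` is smooth. [folklore] -/
theorem contDiff_rsq {n : WithTop ℕ∞} : ContDiff ℝ n rsq := by
  have hc : ∀ j : Fin 3, ContDiff ℝ n (fun y : ℝ³ => y j) := fun j =>
    (EuclideanSpace.proj j : ℝ³ →L[ℝ] ℝ).contDiff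
  unfold rsq
  exact (((hc 0).pow 2).add ((hc 1).pow 2)).add ((hc 2).pow 2)

/-- `D(rsq)(x) = 2x₀ dx₀ + 2x₁ dx₁ + 2x₂ dx₂`. [folklore] -/
theorem hasFDerivAt_rsq (x : ℝ³) :
    HasFDerivAt rsq ((2 * x 0) • (EuclideanSpace.proj (0 : Fin 3) : ℝ³ →L[ℝ] ℝ) +
      (2 * x 1) • (EuclideanSpace.proj (1 : Fin 3) : ℝ³ →L[ℝ] ℝ) +
      (2 * x 2) • (EuclideanSpace.proj (2 : Fin 3) : ℝ³ →L[ℝ] ℝ)) x := by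
  have h : HasFDerivAt (fun y : ℝ³ => y 0 * y 0 + y 1 * y 1 + y 2 * y 2) _ x :=
    (((hasFDerivAt_coord 0 x).mul (hasFDerivAt_coord 0 x)).add
      ((hasFDerivAt_coord 1 x).mul (hasFDerivAt_coord 1 x))).add
      ((hasFDerivAt_coord 2 x).mul (hasFDerivAt_coord 2 x))
  have e : rsq = fun y : ℝ³ => y 0 * y 0 + y 1 * y 1 + y 2 * y 2 := by
    funext y; simp only [rsq]; ring
  rw [e]
  refine h.congr_fderiv ?_
  ext v
  simp
  ring

/-- The field is `Cⁿ` when the profiles are. [folklore] -/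
theorem contDiff_profileField {n : WithTop ℕ∞} (hS : ContDiff ℝ n S) (hP : ContDiff ℝ n P) :
    ContDiff ℝ n (profileField S P) := by
  have hc : ∀ j : Fin 3, ContDiff ℝ n (fun y : ℝ³ => y j) := fun j =>
    (EuclideanSpace.proj j : ℝ³ →L[ℝ] ℝ).contDiff
  have hSr : ContDiff ℝ n fun y : ℝ³ => S (rsq y) := hS.comp contDiff_rsq
  have hPr : ContDiff ℝ n fun y : ℝ³ => P (rsq y) := hP.comp contDiff_rsq
  have e : profileField S P = fun y => (-2 * S (rsq y) * y 0 * y 2) • (EuclideanSpace.single (0 : Fin 3) (1 : ℝ)) +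
      (-2 * S (rsq y) * y 1 * y 2) • (EuclideanSpace.single (1 : Fin 3) (1 : ℝ)) +
      (2 * P (rsq y) + 2 * S (rsq y) * (y 0 ^ 2 + y 1 ^ 2)) • (EuclideanSpace.single (2 : Fin 3) (1 : ℝ)) :=
    funext (profileField_eq S P)
  rw [e]
  have h0 : ContDiff ℝ n fun y : ℝ³ => (-2 * S (rsq y) * y 0 * y 2) • (EuclideanSpace.single (0 : Fin 3) (1 : ℝ)) :=
    (((contDiff_const.mul hSr).mul (hc 0)).mul (hc 2)).smul contDiff_const
  have h1 : ContDiff ℝ n fun y : ℝ³ => (-2 * S (rsq y) * y 1 * y 2) • (EuclideanSpace.single (1 : Fin 3) (1 : ℝ)) :=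
    (((contDiff_const.mul hSr).mul (hc 1)).mul (hc 2)).smul contDiff_const
  have h2 : ContDiff ℝ n fun y : ℝ³ =>
      (2 * P (rsq y) + 2 * S (rsq y) * (y 0 ^ 2 + y 1 ^ 2)) • (EuclideanSpace.single (2 : Fin 3) (1 : ℝ)) :=
    ((contDiff_const.mul hPr).add ((contDiff_const.mul hSr).mul
      (((hc 0).pow 2).add ((hc 1).pow 2)))).smul contDiff_const
  exact (h0.add h1).add h2

/-! ## The Jacobian -/

/-- The Jacobian table of the profile field (row `j` = direction `∂/∂xⱼ`, column `i` =
component; `S'` = the derivative of `S`, `P' = S`; profiles at `|x|²`). [folklore] -/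
def jac (S S' : ℝ → ℝ) (x : ℝ³) : Fin 3 → Fin 3 → ℝ :=
  ![![-4 * S' (rsq x) * x 0 ^ 2 * x 2 - 2 * S (rsq x) * x 2,
      -4 * S' (rsq x) * x 0 * x 1 * x 2,
      8 * S (rsq x) * x 0 + 4 * S' (rsq x) * x 0 * (x 0 ^ 2 + x 1 ^ 2)],
    ![-4 * S' (rsq x) * x 0 * x 1 * x 2,
      -4 * S' (rsq x) * x 1 ^ 2 * x 2 - 2 * S (rsq x) * x 2,
      8 * S (rsq x) * x 1 + 4 * S' (rsq x) * x 1 * (x 0 ^ 2 + x 1 ^ 2)],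
    ![-4 * S' (rsq x) * x 0 * x 2 ^ 2 - 2 * S (rsq x) * x 0,
      -4 * S' (rsq x) * x 1 * x 2 ^ 2 - 2 * S (rsq x) * x 1,
      4 * S (rsq x) * x 2 + 4 * S' (rsq x) * x 2 * (x 0 ^ 2 + x 1 ^ 2)]]

variable {S P S'}

/-- **The Jacobian**: `∂ⱼ uᵢ (x) = jac S P S' x j i` when `S` has derivative `S'` and `P` has
derivative `S` (chain and product rules). [folklore] -/
theorem fderiv_profileField_single (hS : ∀ s, HasDerivAt S (S' s) s) (hP : ∀ s, HasDerivAt P (S s) s)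
    (x : ℝ³) (j i : Fin 3) : fderiv ℝ (profileField S P) x (EuclideanSpace.single j (1 : ℝ)) i = jac S S' x j i := by
  have hρ := hasFDerivAt_rsq x
  have hSx := (hS (rsq x)).comp_hasFDerivAt x hρ
  have hPx := (hP (rsq x)).comp_hasFDerivAt x hρ
  have hq : HasFDerivAt (fun y : ℝ³ => y 0 ^ 2 + y 1 ^ 2)
      ((2 * x 0) • (EuclideanSpace.proj (0 : Fin 3) : ℝ³ →L[ℝ] ℝ) +
        (2 * x 1) • (EuclideanSpace.proj (1 : Fin 3) : ℝ³ →L[ℝ] ℝ)) x := by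
    have h : HasFDerivAt (fun y : ℝ³ => y 0 * y 0 + y 1 * y 1) _ x :=
      ((hasFDerivAt_coord 0 x).mul (hasFDerivAt_coord 0 x)).add
        ((hasFDerivAt_coord 1 x).mul (hasFDerivAt_coord 1 x))
    have e : (fun y : ℝ³ => y 0 ^ 2 + y 1 ^ 2) = fun y : ℝ³ => y 0 * y 0 + y 1 * y 1 := by
      funext y; ring
    rw [e]
    refine h.congr_fderiv ?_
    ext v
    simp
    ring
  have h0 := (((hSx.const_mul (-2)).mul (hasFDerivAt_coord 0 x)).mul
    (hasFDerivAt_coord 2 x)).smul_const (EuclideanSpace.single (0 : Fin 3) (1 : ℝ))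
  have h1 := (((hSx.const_mul (-2)).mul (hasFDerivAt_coord 1 x)).mul
    (hasFDerivAt_coord 2 x)).smul_const (EuclideanSpace.single (1 : Fin 3) (1 : ℝ))
  have h2 := ((hPx.const_mul 2).add ((hSx.const_mul 2).mul hq)).smul_const (EuclideanSpace.single (2 : Fin 3) (1 : ℝ))
  have h : HasFDerivAt (fun y : ℝ³ => (-2 * S (rsq y) * y 0 * y 2) • (EuclideanSpace.single (0 : Fin 3) (1 : ℝ)) +
      (-2 * S (rsq y) * y 1 * y 2) • (EuclideanSpace.single (1 : Fin 3) (1 : ℝ)) +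
      (2 * P (rsq y) + 2 * S (rsq y) * (y 0 ^ 2 + y 1 ^ 2)) • (EuclideanSpace.single (2 : Fin 3) (1 : ℝ))) _ x := (h0.add h1).add h2
  have e : profileField S P = fun y => (-2 * S (rsq y) * y 0 * y 2) • (EuclideanSpace.single (0 : Fin 3) (1 : ℝ)) +
      (-2 * S (rsq y) * y 1 * y 2) • (EuclideanSpace.single (1 : Fin 3) (1 : ℝ)) +
      (2 * P (rsq y) + 2 * S (rsq y) * (y 0 ^ 2 + y 1 ^ 2)) • (EuclideanSpace.single (2 : Fin 3) (1 : ℝ)) :=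
    funext (profileField_eq S P)
  rw [e, h.fderiv]
  fin_cases j <;> fin_cases i <;> simp [jac] <;> ring

/-- The field is differentiable when `S` is differentiable and `P' = S`. [folklore] -/
theorem differentiable_profileField (hS : ∀ s, HasDerivAt S (S' s) s)
    (hP : ∀ s, HasDerivAt P (S s) s) : Differentiable ℝ (profileField S P) := by
  intro x
  have hρ := hasFDerivAt_rsq x
  have hSx := (hS (rsq x)).comp_hasFDerivAt x hρ
  have hPx := (hP (rsq x)).comp_hasFDerivAt x hρ
  have hc : ∀ j : Fin 3, DifferentiableAt ℝ (fun y : ℝ³ => y j) x := fun j =>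
    (hasFDerivAt_coord j x).differentiableAt
  have e : profileField S P = fun y => (-2 * S (rsq y) * y 0 * y 2) • (EuclideanSpace.single (0 : Fin 3) (1 : ℝ)) +
      (-2 * S (rsq y) * y 1 * y 2) • (EuclideanSpace.single (1 : Fin 3) (1 : ℝ)) +
      (2 * P (rsq y) + 2 * S (rsq y) * (y 0 ^ 2 + y 1 ^ 2)) • (EuclideanSpace.single (2 : Fin 3) (1 : ℝ)) :=
    funext (profileField_eq S P)
  rw [e]
  have hS' : DifferentiableAt ℝ (fun y : ℝ³ => S (rsq y)) x := hSx.differentiableAt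
  have hP' : DifferentiableAt ℝ (fun y : ℝ³ => P (rsq y)) x := hPx.differentiableAt
  have h0 : DifferentiableAt ℝ (fun y : ℝ³ => (-2 * S (rsq y) * y 0 * y 2) • (EuclideanSpace.single (0 : Fin 3) (1 : ℝ))) x :=
    (((hS'.const_mul (-2)).mul (hc 0)).mul (hc 2)).smul_const _
  have h1 : DifferentiableAt ℝ (fun y : ℝ³ => (-2 * S (rsq y) * y 1 * y 2) • (EuclideanSpace.single (1 : Fin 3) (1 : ℝ))) x :=
    (((hS'.const_mul (-2)).mul (hc 1)).mul (hc 2)).smul_const _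
  have h2 : DifferentiableAt ℝ (fun y : ℝ³ =>
      (2 * P (rsq y) + 2 * S (rsq y) * (y 0 ^ 2 + y 1 ^ 2)) • (EuclideanSpace.single (2 : Fin 3) (1 : ℝ))) x :=
    ((hP'.const_mul 2).add ((hS'.const_mul 2).mul (((hc 0).pow 2).add ((hc 1).pow 2)))).smul_const _
  exact (h0.add h1).add h2

/-! ## Divergence, curl, swirl, axisymmetry -/

/-- The profile quotient `−(10 S(s) + 4 s S'(s))`: the value of `ω_θ / r` of the profile field at
`|x|² = s` (`curl_profileField`). [folklore] -/
def quotOf (S S' : ℝ → ℝ) (s : ℝ) : ℝ := -(10 * S s + 4 * s * S' s)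

/-- **The profile field is divergence free** (`P' = S`). [cite: Acheson1990, §5.5, eq. (5.25)] -/
theorem isDivFree_profileField (hS : ∀ s, HasDerivAt S (S' s) s) (hP : ∀ s, HasDerivAt P (S s) s) :
    VectorCalculus.IsDivFree (profileField S P) := fun x => by
  rw [VectorCalculus.divergence, trace_eq_sum_coord, Fin.sum_univ_three,
    fderiv_profileField_single hS hP, fderiv_profileField_single hS hP,
    fderiv_profileField_single hS hP]
  simp [jac, rsq]
  ring

/-- **The vorticity of the profile field**: `curl u (x) = quotOf S S' (|x|²) • (−x₁, x₀, 0)`, i.e.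
`ω = (ω_θ/r) · J x` with `ω_θ/r = −(10 S + 4 |x|² S')` (Hill's core: `S' = 0`, `ω_θ/r = −10 S`
constant — Acheson (5.16)/(5.25), tree `hill_core_vorticity`).
[cite: Acheson1990, §5.5, eqs. (5.16) and (5.25)] -/
theorem curl_profileField (hS : ∀ s, HasDerivAt S (S' s) s) (hP : ∀ s, HasDerivAt P (S s) s)
    (x : ℝ³) : curl (profileField S P) x = quotOf S S' (rsq x) • rotGen x := by
  rw [curl_eq_curlCLM, curlCLM_apply]
  simp only [fderiv_profileField_single hS hP]
  ext i
  fin_cases i <;> simp [jac, quotOf, rotGen, rsq] <;> ring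

/-- The profile field has NO SWIRL: `x₀ u₁ − x₁ u₀ = 0`. [cite: Acheson1990, §5.5, eq. (5.15)] -/
theorem hasNoSwirl_profileField : HasNoSwirl (profileField S P) := fun x => by
  simp only [swirl, profileField_apply_zero, profileField_apply_one]
  ring

/-- `rsq` is invariant under the rotations about the axis. [folklore] -/
theorem rsq_rotZ (θ : ℝ) (x : ℝ³) : rsq (rotZ θ x) = rsq x := by
  simp only [rsq, rotZ_apply_zero, rotZ_apply_one, rotZ_apply_two]
  linear_combination (x 0 ^ 2 + x 1 ^ 2) * Real.sin_sq_add_cos_sq θ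

/-- The profile field is AXISYMMETRIC: `u (R_θ x) = R_θ (u x)`. [cite: Acheson1990, §5.5, eq. (5.15)] -/
theorem isAxisymmetric_profileField : IsAxisymmetric (profileField S P) := by
  intro θ x
  ext i
  fin_cases i
  · show profileField S P (rotZ θ x) 0 = rotZ θ (profileField S P x) 0
    rw [profileField_apply_zero, rotZ_apply_zero, rsq_rotZ, rotZ_apply_zero, rotZ_apply_two,
      profileField_apply_zero, profileField_apply_one]
    ring
  · show profileField S P (rotZ θ x) 1 = rotZ θ (profileField S P x) 1
    rw [profileField_apply_one, rotZ_apply_one, rsq_rotZ, rotZ_apply_one, rotZ_apply_two,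
      profileField_apply_zero, profileField_apply_one]
    ring
  · show profileField S P (rotZ θ x) 2 = rotZ θ (profileField S P x) 2
    rw [profileField_apply_two, rotZ_apply_two, rsq_rotZ, rotZ_apply_zero, rotZ_apply_one,
      profileField_apply_two]
    linear_combination (2 * S (rsq x) * (x 0 ^ 2 + x 1 ^ 2)) * Real.sin_sq_add_cos_sq θ

/-- The swirl of the vorticity: `swirl (curl u) x = quotOf S S' (|x|²) · (x₀² + x₁²)`, i.e.
`r ω_θ = (ω_θ/r) r²`. [folklore] -/
theorem swirl_curl_profileField (hS : ∀ s, HasDerivAt S (S' s) s)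
    (hP : ∀ s, HasDerivAt P (S s) s) (x : ℝ³) :
    swirl (curl (profileField S P)) x = quotOf S S' (rsq x) * (x 0 ^ 2 + x 1 ^ 2) := by
  simp only [swirl, curl_profileField hS hP, PiLp.smul_apply, smul_eq_mul, rotGen_apply_zero,
    rotGen_apply_one]
  ring

/-- **`ω_θ / r` of the profile field is `quotOf S S' (|x|²)` EVERYWHERE** (smooth profiles,
`S' = S.deriv`, `P' = S`): off the axis from `r² · (ω_θ/r) = swirl (curl u)`, on the axis by
continuity. [cite: KochNadirashviliSereginSverak2009, §5 Remark 5.1] -/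
theorem angVortQuot_profileField (hSc : ContDiff ℝ ∞ S) (hPc : ContDiff ℝ ∞ P)
    (hS : ∀ s, HasDerivAt S (S' s) s) (hP : ∀ s, HasDerivAt P (S s) s) (hS'c : Continuous S')
    (x : ℝ³) : angVortQuot (profileField S P) x = quotOf S S' (rsq x) := by
  have hu : ContDiff ℝ 3 (profileField S P) := contDiff_infty.1 (contDiff_profileField S P hSc hPc) 3
  have hcont : Continuous (angVortQuot (profileField S P)) :=
    (contDiff_angVortQuot (n := 0) (by exact_mod_cast hu)).continuous
  have hq : Continuous fun y : ℝ³ => quotOf S S' (rsq y) := by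
    have hr : Continuous rsq := contDiff_rsq (n := 0) |>.continuous
    unfold quotOf
    exact ((continuous_const.mul (hSc.continuous.comp hr)).add
      ((continuous_const.mul hr).mul (hS'c.comp hr))).neg
  refine eq_of_eq_off_ker (EuclideanSpace.proj (0 : Fin 3) : ℝ³ →L[ℝ] ℝ)
    ⟨EuclideanSpace.single 0 1, by simp⟩ hcont hq (fun z hz => ?_) x
  have hz0 : z 0 ≠ 0 := by simpa using hz
  have hr : cylRadius z ^ 2 ≠ 0 := by
    rw [cylRadius_sq]; positivity
  have key := (isAxisymmetric_profileField (S := S) (P := P)).cylRadius_sq_mul_angVortQuot hu z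
  rw [swirl_curl_profileField hS hP, ← cylRadius_sq] at key
  exact mul_left_cancel₀ hr (by rw [key, mul_comm])

/-- **The speed in closed form**: `‖u(x)‖² = 4 S² x₂² (x₀² + x₁²) + (2P + 2S (x₀² + x₁²))²`
(profiles at `|x|²`). [folklore] -/
theorem norm_sq_profileField (x : ℝ³) : ‖profileField S P x‖ ^ 2 =
    4 * S (rsq x) ^ 2 * x 2 ^ 2 * (x 0 ^ 2 + x 1 ^ 2) +
      (2 * P (rsq x) + 2 * S (rsq x) * (x 0 ^ 2 + x 1 ^ 2)) ^ 2 := by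
  rw [EuclideanSpace.real_norm_sq_eq, Fin.sum_univ_three, profileField_apply_zero,
    profileField_apply_one, profileField_apply_two]
  ring

end SmoothedHill

end Summit.NavierStokesRegularity.FluidComputer

end
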